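import Literature.MathematicalPhysics.QuantumFieldTheory.Balaban1983to89.B5DPD127HolderUniform
import Literature.MathematicalPhysics.QuantumFieldTheory.Balaban1983to89.B5

/-!
# `Balaban1983to89.B5Kernel126TorusInstance` — T. Bałaban, *Propagators and renormalization transformations for
# lattice gauge theories. I*, Commun. Math. Phys. **95** (1984) 17–40 [Balaban1984PropagatorsI]:
# the kernel bounds (1.126)–(1.127) for `∂P∂*` — the abstract-carrier statement `B5.Kernel126_127Printed`
# INHABITED BY NAME for the concrete torus family, with ONE rate `δ′₀` serving (1.126) and (1.127) for every `α < 1`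

statement-level skeleton of published theorems with citation tags; proofs where landed; nothing here is a claim about the Yang–Mills mass gap

PDF held: `paper:balaban1984-cmp95-propagators-rt-i` (journal page = PDF page + 16); p. 38 = PDF p. 22.

WHAT IS REPRODUCED.  SKELETON row **B5.Eq1.127** ((1.126)–(1.127) p. 38) of `run/shared/lean/pub/lit-balaban/SKELETON.md`
(= INTERFACES.md §1 row `B5.Eq1.126`, decl of record `B5.Kernel126_127Printed`, NE consumer F-T4-151), so far
«typed-existing (`B5.Kernel126_127Printed`) + proved-existing (torus multiplier presentation)»: the cell's
`B5DPD126Uniform.dpd_decay_uniform` is (1.126) and `B5DPD127HolderUniform.dpd_holder_uniform` is (1.127), both `k`- and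
volume-uniform, for the `η`-weighted kernel `dpd n a N μ ν` of `∂_μ P ∂_ν^*` — but the latter is packaged `∀ α ∃ (δ, C)`,
whereas the printed sentence (and its transcription `B5.Kernel126_127Printed`) has ONE rate: «The constant O(1) in (1.126)
depends on d only, and in (1.127) it depends on α also (O(1) → ∞ if α → 1)» — `δ′₀` does not depend on `α`.  Reader/typer seat
**r02** (gen 4, B5 fold owner) of the cell `lit-balaban`, HOME `run/shared/lean/pub/lit-balaban/`.  Kind «model-instance».

## The printed text (p. 38 [PDF 22]; verbatim)

«Let us write bounds for the operator ∂P∂*. They follow from the representation P = G′Q′*(Q′G′²Q′*)⁻¹Q′G′, from Lemma 2.4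
of [2], and the representation (1.45) and the analyticity method of proving an exponential decay (see the proof of Lemma 2.4
in [2]). We obtain
  |(∂P∂*)_{μ,ν}(x, x′)| ≦ O(1)e^{−δ′₀|x−x′|},                                                            (1.126)
  (1/|x − x′|^α)|(∂P∂*)_{μ,ν}(x, x″) − (∂P∂*)_{μ,ν}(x′, x″)| ≦ O(1)e^{−δ′₀|x−x″|}  for x, x′: |x − x′| ≦ 1, α < 1.   (1.127)
The constant O(1) in (1.126) depends on d only, and in (1.127) it depends on α also (O(1) → ∞ if α → 1).»

## What is certified (kernel, zero `sorry`, axioms ⊆ {propext, Classical.choice, Quot.sound})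

* §1–§4 **the `α`-UNIFORM RATE.**  b04's chain `B4StripSumsHolder.holder248_stripRegular` → `hkernel248_torusKernel_decay_torusMetric`
  → `B5DPD127HolderUniform.HDKRe_decay` → `dpd_holder_uniform` is re-threaded with the quantifier order `∃ κ ∀ α ∃ M`, which
  its own construction supports: in `holder248_stripRegular` the half-width is `κ = min κ₁ (rOf (d+1))` with `κ₁` from
  `B4StripCauchy.uniformStrip_holds` — no `α` — and `α` enters only the bound `M = boundGH d α c (max m²₊ 0)` (finite exactly
  for `α < 1`: the printed «O(1) → ∞ if α → 1»).  Results: `holder248_stripRegular_unifAlpha`,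
  `hkernel248_torusKernel_decay_unifAlpha`, `HDKRe_decay_unifAlpha`, `dpd_holder_unifAlpha` (+ fine-distance form
  `dpd_holder_unifAlpha_fine`).  The proofs are the cell's, verbatim up to the quantifier bookkeeping.
* §5 the side condition «x, x′: |x − x′| ≦ 1» in coordinates: the centred representative `sigmaOf x x′ ∈ ℤ^{d+1}` of `x′ − x`
  on the fine torus (`tsh (sigmaOf x x′) x = x′`, `supNorm (sigmaOf x x′) = tdist x x′`), so that the cell's shift-indexed
  Hölder quotient `(n/|σ|_∞)^α·|dpd(x+σ, x″) − dpd(x, x″)|` is the printed `|x − x′|^{−α}|(∂P∂*)(x′,x″) − (∂P∂*)(x,x″)|`.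
* §6 **`kernel126_127Printed_torus : B5.Kernel126_127Printed (K126 (d := d) aminus aplus)`** — the decl of record HOLDS for the
  family of concrete kernels `K126 i = ⟨fine torus Π_j ℤ/(n N_j), |x − x′| := tdist(x,x′)/n (sup-distance in lattice units
  η = 1/n), (∂P∂*)_{μν}(x,x′) := dpd n a N μ ν x x′⟩` indexed by `i = (n ≥ 1, a ∈ [a₋, a₊], N ≥ 1, μ, ν)` (every `k`: `n = L^k`;
  every volume; every `a` in a compact range, in particular the paper's `a = 1`), with ONE `δ′₀ = min(δ₁₂₆, δ₁₂₇) > 0`, one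
  `C` («depends on d only» — here on `d, a₋, a₊`) and `C_α` («depends on α also»); exponents `α < 0` (allowed by the typed
  `α < 1`) are served by the `α = 0` bound since `|x − x′| ≤ 1`, and `x = x′` is trivial.

## What is NOT claimed

No value of `δ′₀`, `O(1)` is attributed to the paper.  Printed dimension `d` = the cell's `d + 1` (as in `B5DPD126Uniform`).  The
identification of `dpd` with the position-space operator `∂P∂*` of (1.120) is the cell's `B5DPD126Uniform.Dmat_matrixP_Dmat_transpose`
(not re-derived here).  Nothing here is progress on a summit; value = an INTERFACES §1 statement consumed downstream as a
hypothesis `(h : B5.Kernel126_127Printed K)` is now inhabited by its intended model, kernel-checked.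
-/

namespace Literature.MathematicalPhysics.QuantumFieldTheory.Balaban1983to89.B5Kernel126TorusInstance

open Complex Finset UnitAddTorus
open Literature.MathematicalPhysics.QuantumFieldTheory.Balaban1983to89
open Literature.MathematicalPhysics.QuantumFieldTheory.Balaban1983to89.B4Strip
open Literature.MathematicalPhysics.QuantumFieldTheory.Balaban1983to89.B4StripCauchy
open Literature.MathematicalPhysics.QuantumFieldTheory.Balaban1983to89.B5Strip145Analytic
open Literature.MathematicalPhysics.QuantumFieldTheory.Balaban1983to89.B5Strip145Decay
open Literature.MathematicalPhysics.QuantumFieldTheory.Balaban1983to89.B4ContourShift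
open Literature.MathematicalPhysics.QuantumFieldTheory.Balaban1983to89.B4StripSums
open Literature.MathematicalPhysics.QuantumFieldTheory.Balaban1983to89.B4StripSumsHolder
open Literature.MathematicalPhysics.QuantumFieldTheory.Balaban1983to89.B4StripSumsDeriv
open Literature.MathematicalPhysics.QuantumFieldTheory.Balaban1983to89.B4TorusKernel
open Literature.MathematicalPhysics.QuantumFieldTheory.Balaban1983to89.B4Torus248Decay
open Literature.MathematicalPhysics.QuantumFieldTheory.Balaban1983to89.B4Green244
open Literature.MathematicalPhysics.QuantumFieldTheory.Balaban1983to89.B4TorusGreen244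
open Literature.MathematicalPhysics.QuantumFieldTheory.Balaban1983to89.B4Sect5Torus
open Literature.MathematicalPhysics.QuantumFieldTheory.Balaban1983to89.B5Torus145Decay
open Literature.MathematicalPhysics.QuantumFieldTheory.Balaban1983to89.B5QGGQ145Torus
open Literature.MathematicalPhysics.QuantumFieldTheory.Balaban1983to89.B5QGGQ145Bounds
open Literature.MathematicalPhysics.QuantumFieldTheory.Balaban1983to89.B5QGGQ145Factor
open Literature.MathematicalPhysics.QuantumFieldTheory.Balaban1983to89.B5DPD126Uniform
open Literature.MathematicalPhysics.QuantumFieldTheory.Balaban1983to89.B5DPD127HolderUniform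
open scoped Real Matrix

noncomputable section

variable {d : ℕ}

/-! ### §1 B4 Lemma 2.4 (2.36): strip regularity of the Hölder multiplier with an `α`-independent half-width -/

/-- **B4 LEMMA 2.4 (2.36), MULTIPLIER FORM, `α`-UNIFORM HALF-WIDTH.**  For `0 < a₋ ≤ a₊`, `m²₊` there is ONE `κ > 0` such that
for every `0 ≤ α < 1` there is `M ≥ 0` (depending on `α`) with: for every `n ≥ 1`, `a ∈ [a₋,a₊]`, `m² ∈ [0,m²₊]`, `τ`, `μ`,
`σ ≠ 0` with `|σ_ν| ≤ n`, the Hölder multiplier `GH_{α,n,a,m²,τ,μ,σ}` is `StripRegular` on `Strip (d+1) κ` with bound `M`.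
Same construction as `B4StripSumsHolder.holder248_stripRegular` (`κ = min κ₁ (rOf (d+1))`, `κ₁` from `uniformStrip_holds`;
`M = boundGH d α c (max m²₊ 0)`), only the quantifiers are ordered as the construction allows.
[cite: Balaban1983RegularityDecay, Lemma 2.4 (2.36) p.582 with (2.49)–(2.51) pp.585–586; Balaban1984PropagatorsI p.38
«in (1.127) it depends on α also»; proof supplied by the audit along the printed method] -/
theorem holder248_stripRegular_unifAlpha (d : ℕ) (aminus aplus m2plus : ℝ) (ha : 0 < aminus) :
    ∃ κ : ℝ, 0 < κ ∧ ∀ {α : ℝ}, 0 ≤ α → α < 1 → ∃ M : ℝ, 0 ≤ M ∧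
      ∀ (n : ℕ) [NeZero n] (a m2 : ℝ), aminus ≤ a → a ≤ aplus → 0 ≤ m2 →
        m2 ≤ m2plus → ∀ (τ : Fin (d + 1) → Fin n) (μ : Fin (d + 1)) (σ : Fin (d + 1) → ℤ), σ ≠ 0 →
          (∀ ν, |σ ν| ≤ n) → StripRegular (d := d) (GH α n a m2 τ μ σ) κ M := by
  obtain ⟨κ₁, c, hκ₁, hc, h⟩ := uniformStrip_holds (d + 1) aminus aplus m2plus ha
  refine ⟨min κ₁ (rOf (d + 1)), lt_min hκ₁ (rOf_pos _), fun {α} hα0 hα1 => ?_⟩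
  refine ⟨boundGH d α c (max m2plus 0), boundGH_nonneg _ α hc (le_max_right _ _), ?_⟩
  intro n _ a m2 ha1 ha2 hm hmp τ μ σ hσ0 hσn
  have hκ0 : 0 ≤ min κ₁ (rOf (d + 1)) := (lt_min hκ₁ (rOf_pos _)).le
  have hsub : Strip (d + 1) (min κ₁ (rOf (d + 1))) ⊆ Strip (d + 1) κ₁ := strip_mono (min_le_left _ _)
  exact stripRegular_GH n a m2 (max m2plus 0) hm (hmp.trans (le_max_left _ _)) τ μ hσ0 hσn hα0 hα1 hκ0
    (min_le_right _ _) hc (fun p hp => h n a m2 ha1 ha2 hm hmp p (hsub hp))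

/-! ### §2 … hence decay of the torus kernel of the Hölder quotient with an `α`-independent rate -/

/-- **B4 LEMMA 2.4 (2.36) ON THE TORUS, `α`-UNIFORM RATE**: ONE `κ > 0` (from `d, a₋, a₊, m²₊`) such that for every
`0 ≤ α < 1` there is `M ≥ 0` with `‖torusKernelH248 α n a m2 τ μ σ N x⁰‖ ≤ M · periodConst κ d · e^{−(κ/(d+1))·torusSupNorm N x⁰}`
for every `n ≥ 1`, `a ∈ [a₋,a₊]`, `m² ∈ [0,m²₊]`, `τ`, `μ`, `σ ≠ 0` with `|σ_ν| ≤ n`, every period vector `N ≥ 1`, every `x⁰`.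
[cite: Balaban1983RegularityDecay, Lemma 2.4 (2.36) p.582; Balaban1984PropagatorsI p.36 l.20–23 and p.38;
proof supplied by the audit, not printed] -/
theorem hkernel248_torusKernel_decay_unifAlpha (d : ℕ) (aminus aplus m2plus : ℝ) (ha : 0 < aminus) :
    ∃ κ : ℝ, 0 < κ ∧ ∀ {α : ℝ}, 0 ≤ α → α < 1 → ∃ M : ℝ, 0 ≤ M ∧
      ∀ (n : ℕ) [NeZero n] (a m2 : ℝ), aminus ≤ a → a ≤ aplus → 0 ≤ m2 →
        m2 ≤ m2plus → ∀ (τ : Fin (d + 1) → Fin n) (μ : Fin (d + 1)) (σ : Fin (d + 1) → ℤ), σ ≠ 0 →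
          (∀ ν, |σ ν| ≤ n) → ∀ (N : Fin (d + 1) → ℕ), (∀ i, 1 ≤ N i) → ∀ x : Fin (d + 1) → ℤ,
            ‖torusKernelH248 α n a m2 τ μ σ N x‖
              ≤ M * periodConst κ d * Real.exp (-(κ / (d + 1) * MultiPeriod.torusSupNorm N x)) := by
  obtain ⟨κ, hκ, h⟩ := holder248_stripRegular_unifAlpha d aminus aplus m2plus ha
  refine ⟨κ, hκ, fun {α} hα0 hα1 => ?_⟩
  obtain ⟨M, hM, hreg⟩ := h hα0 hα1
  refine ⟨M, hM, ?_⟩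
  intro n _ a m2 ha1 ha2 hm hmp τ μ σ hσ0 hσn N hN x
  have hr := hreg n a m2 ha1 ha2 hm hmp τ μ σ hσ0 hσn
  rw [torusKernelH248_eq_torusKernel α n a m2 τ μ σ hr hκ.le N x]
  exact MultiPeriod.torusKernel_descend_decay_torusMetric hr hκ hN x

/-! ### §3 … hence decay of the Hölder quotient of the factor `∂_μ(G′Q′^*)` with an `α`-independent rate -/

/-- **THE HÖLDER QUOTIENT OF `∂^η_μ(G′_kQ′_k^*)` DECAYS WITH AN `α`-INDEPENDENT RATE**: ONE `κ > 0` (from `d, a₋, a₊`) such that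
for every `0 ≤ α < 1` there is `M ≥ 0` with `|HDKRe α n a N μ σ (x,k)| ≤ M·periodConst κ d·e^{−(κ/(d+1))·|⌊x/n⌋ − k|_{T₁}}` for
every `n ≥ 1`, `a ∈ [a₋,a₊]`, `N ≥ 1`, `μ`, `σ ≠ 0` with `|σ_i| ≤ n`, `x`, `k` (the cell's `HDKRe_decay` with the quantifiers
re-ordered). [cite: Balaban1983RegularityDecay, Lemma 2.4 (2.36) p.582; Balaban1984PropagatorsI (1.127) p.38 «from Lemma
2.4 of [2]»; proof supplied by the audit] -/
theorem HDKRe_decay_unifAlpha (d : ℕ) (aminus aplus : ℝ) (ha : 0 < aminus) :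
    ∃ κ : ℝ, 0 < κ ∧ ∀ {α : ℝ}, 0 ≤ α → α < 1 → ∃ M : ℝ, 0 ≤ M ∧
      ∀ (n : ℕ) [NeZero n] (a : ℝ), aminus ≤ a → a ≤ aplus →
        ∀ (N : Fin (d + 1) → ℕ), (∀ i, 1 ≤ N i) → ∀ (μ : Fin (d + 1)) (σ : Fin (d + 1) → ℤ), σ ≠ 0 →
          (∀ i, |σ i| ≤ n) → ∀ (x : Idx (fun i => n * N i)) (k : Idx N),
            |HDKRe α n a N μ σ x k| ≤ M * periodConst κ d *
              Real.exp (-(κ / (d + 1) * MultiPeriod.torusSupNorm N (coarse n (toZ x) - toZ k))) := by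
  obtain ⟨κ, hκ, h⟩ := hkernel248_torusKernel_decay_unifAlpha d aminus aplus 0 ha
  refine ⟨κ, hκ, fun {α} hα0 hα1 => ?_⟩
  obtain ⟨M, hM, hMb⟩ := h hα0 hα1
  refine ⟨M, hM, fun n _ a ha1 ha2 N hN μ σ hσ0 hσn x k => ?_⟩
  rw [HDKRe_eq α n a hN]
  exact (Complex.abs_re_le_norm _).trans
    (hMb n a 0 ha1 ha2 le_rfl le_rfl (offset n (toZ x)) μ σ hσ0 hσn N hN (coarse n (toZ x) - toZ k))

/-! ### §4 (1.127) for the kernel `dpd` of `∂_μ P ∂_ν^*` with an `α`-independent rate -/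

/-- **(1.127) WITH ONE RATE FOR ALL `α`**: for `0 < a₋ ≤ a₊` there is `δ > 0` (from `d, a₋, a₊` only) such that for every
`0 ≤ α < 1` there is `C ≥ 0` (depending on `α` also) with, for EVERY `n ≥ 1`, `a ∈ [a₋, a₊]`, `N ≥ 1`, `μ, ν`, `σ ≠ 0` with
`|σ_i| ≤ n` and all fine torus points `x, x″`:
`(n/|σ|_∞)^α · |dpd(x+σ, x″) − dpd(x, x″)| ≤ C · e^{−δ·|⌊x/n⌋ − ⌊x″/n⌋|_{T₁}}`.  The cell's `dpd_holder_uniform`, its proof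
repeated with the `α`-uniform first factor `HDKRe_decay_unifAlpha`. [cite: Balaban1984PropagatorsI, (1.127) p.38 with
«The constant O(1) in (1.126) depends on d only, and in (1.127) it depends on α also (O(1) → ∞ if α → 1)»; proof supplied
by the audit (composition over the unit torus)] -/
theorem dpd_holder_unifAlpha (d : ℕ) (aminus aplus : ℝ) (ha : 0 < aminus) :
    ∃ δ : ℝ, 0 < δ ∧ ∀ {α : ℝ}, 0 ≤ α → α < 1 → ∃ C : ℝ, 0 ≤ C ∧
      ∀ (n : ℕ) [NeZero n] (a : ℝ), aminus ≤ a → a ≤ aplus →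
        ∀ (N : Fin (d + 1) → ℕ), (∀ i, 1 ≤ N i) → ∀ (μ ν : Fin (d + 1)) (σ : Fin (d + 1) → ℤ), σ ≠ 0 →
          (∀ i, |σ i| ≤ n) → ∀ (x x'' : Idx (fun i => n * N i)),
            ((n : ℝ) / supNorm σ) ^ α * |dpd n a N μ ν (tsh σ x) x'' - dpd n a N μ ν x x''| ≤
              C * Real.exp (-(δ * MultiPeriod.torusSupNorm N (coarse n (toZ x) - coarse n (toZ x'')))) := by
  obtain ⟨κ₁, M₁, hκ₁, hM₁, h₁⟩ := DKRe_decay d aminus aplus ha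
  obtain ⟨κ₂, M₂, hκ₂, hM₂, h₂⟩ := kerRe_decay d aminus aplus ha
  obtain ⟨κ₃, hκ₃, h₃u⟩ := HDKRe_decay_unifAlpha d aminus aplus ha
  have hd1 : (0 : ℝ) < (d : ℝ) + 1 := by positivity
  set r : ℝ := min (min κ₁ κ₂) κ₃ / ((d : ℝ) + 1) with hr_def
  have hr : 0 < r := div_pos (lt_min (lt_min hκ₁ hκ₂) hκ₃) hd1
  have hr₁ : r ≤ κ₁ / ((d : ℝ) + 1) :=
    div_le_div_of_nonneg_right ((min_le_left _ _).trans (min_le_left _ _)) hd1.le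
  have hr₂ : r ≤ κ₂ / ((d : ℝ) + 1) :=
    div_le_div_of_nonneg_right ((min_le_left _ _).trans (min_le_right _ _)) hd1.le
  have hr₃ : r ≤ κ₃ / ((d : ℝ) + 1) := div_le_div_of_nonneg_right (min_le_right _ _) hd1.le
  set A : ℝ := M₁ * periodConst κ₁ d with hA_def
  set B : ℝ := M₂ * periodConst κ₂ d with hB_def
  have hA : 0 ≤ A := mul_nonneg hM₁ (periodConst_nonneg_of_pos hκ₁ d)
  have hB : 0 ≤ B := mul_nonneg hM₂ (periodConst_nonneg_of_pos hκ₂ d)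
  have hK2 : 0 ≤ B4Sect5Proof.latticeConst (d + 1) (r / 2) := B4Sect5Proof.latticeConst_nonneg (d + 1) (by positivity)
  have hK4 : 0 ≤ B4Sect5Proof.latticeConst (d + 1) (r / 2 / 2) :=
    B4Sect5Proof.latticeConst_nonneg (d + 1) (by positivity)
  refine ⟨r / 2 / 2, by positivity, fun {α} hα0 hα1 => ?_⟩
  obtain ⟨M₃, hM₃, h₃⟩ := h₃u hα0 hα1
  set H : ℝ := M₃ * periodConst κ₃ d with hH_def
  have hH : 0 ≤ H := mul_nonneg hM₃ (periodConst_nonneg_of_pos hκ₃ d)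
  refine ⟨H * B * B4Sect5Proof.latticeConst (d + 1) (r / 2) * A *
    B4Sect5Proof.latticeConst (d + 1) (r / 2 / 2), by positivity, ?_⟩
  intro n _ a ha1 ha2 N hN μ ν σ hσ0 hσn x x''
  -- the three factor bounds, in the torus distance on the unit torus, at the common rate `r`
  have hHD : ∀ k : Idx N, |HDKRe α n a N μ σ x k| ≤ H * Real.exp (-(r * tdist N (cIdx n N x) k)) := by
    intro k
    refine (h₃ n a ha1 ha2 N hN μ σ hσ0 hσn x k).trans ?_
    rw [tdist_eq_torusSupNorm hN, toZ_cIdx]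
    apply mul_le_mul_of_nonneg_left _ hH
    apply Real.exp_le_exp.mpr
    have hT := MultiPeriod.torusSupNorm_nonneg hN (coarse n (toZ x) - toZ k)
    nlinarith
  have hDK : ∀ (z : Idx (fun i => n * N i)) (k : Idx N),
      |DKRe n a N ν z k| ≤ A * Real.exp (-(r * tdist N (cIdx n N z) k)) := by
    intro z k
    refine (h₁ n a ha1 ha2 N hN ν z k).trans ?_
    rw [tdist_eq_torusSupNorm hN, toZ_cIdx]
    apply mul_le_mul_of_nonneg_left _ hA
    apply Real.exp_le_exp.mpr
    have hT := MultiPeriod.torusSupNorm_nonneg hN (coarse n (toZ z) - toZ k)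
    nlinarith
  have hker : ∀ k k' : Idx N, |kerRe n a N k k'| ≤ B * Real.exp (-(r * tdist N k k')) := by
    intro k k'
    refine (h₂ n a ha1 ha2 N hN k k').trans ?_
    rw [tdist_eq_torusSupNorm hN]
    apply mul_le_mul_of_nonneg_left _ hB
    apply Real.exp_le_exp.mpr
    have hT := MultiPeriod.torusSupNorm_nonneg hN (toZ k - toZ k')
    nlinarith
  -- first composition: Hölder quotient of `∂_μ(G′Q′^*)` times `(Q′G′²Q′^*)⁻¹`
  have hconv1 : ∀ y' : Idx N, |(HDKRe α n a N μ σ * kerRe n a N) x y'| ≤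
      H * B * B4Sect5Proof.latticeConst (d + 1) (r / 2) * Real.exp (-(r / 2 * tdist N (cIdx n N x) y')) := by
    intro y'
    rw [Matrix.mul_apply]
    exact conv_decay hN hr _ _ (cIdx n N x) y' (fun y => hHD y) (fun y => hker y y')
  -- second composition: `· (∂_ν(G′Q′^*))ᵀ`
  have hconv2 : |(HDKRe α n a N μ σ * kerRe n a N * (DKRe n a N ν)ᵀ) x x''| ≤
      H * B * B4Sect5Proof.latticeConst (d + 1) (r / 2) * A * B4Sect5Proof.latticeConst (d + 1) (r / 2 / 2) *
        Real.exp (-(r / 2 / 2 * tdist N (cIdx n N x) (cIdx n N x''))) := by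
    rw [Matrix.mul_apply]
    refine conv_decay hN (half_pos hr) _ _ (cIdx n N x) (cIdx n N x'') hconv1 ?_
    intro y'
    rw [Matrix.transpose_apply, tdist_symm hN]
    refine (hDK x'' y').trans ?_
    apply mul_le_mul_of_nonneg_left _ hA
    apply Real.exp_le_exp.mpr
    have ht := mul_nonneg hr.le (tdist_nonneg N (cIdx n N x'') y')
    nlinarith
  rw [tdist_eq_torusSupNorm hN, toZ_cIdx, toZ_cIdx, ← holderQuot_dpd_eq] at hconv2
  have hc : 0 ≤ ((n : ℝ) / supNorm σ) ^ α := Real.rpow_nonneg (div_nonneg (Nat.cast_nonneg n) (supNorm_nonneg σ)) α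
  rwa [abs_mul, abs_of_nonneg hc] at hconv2

/-- **(1.127) WITH ONE RATE, FINE TORUS DISTANCE IN THE EXPONENT**: as `dpd_holder_unifAlpha` with
`e^{−(δ/n)·tdist_{T_η}(x,x″)}`, `(1/n)·tdist_{T_η} = |x − x″|` in lattice units (`B5DPD126Uniform.tdist_fine_le`).
[cite: Balaban1984PropagatorsI, (1.127) p.38; proof supplied by the audit] -/
theorem dpd_holder_unifAlpha_fine (d : ℕ) (aminus aplus : ℝ) (ha : 0 < aminus) :
    ∃ δ : ℝ, 0 < δ ∧ ∀ {α : ℝ}, 0 ≤ α → α < 1 → ∃ C : ℝ, 0 ≤ C ∧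
      ∀ (n : ℕ) [NeZero n] (a : ℝ), aminus ≤ a → a ≤ aplus →
        ∀ (N : Fin (d + 1) → ℕ), (∀ i, 1 ≤ N i) → ∀ (μ ν : Fin (d + 1)) (σ : Fin (d + 1) → ℤ), σ ≠ 0 →
          (∀ i, |σ i| ≤ n) → ∀ (x x'' : Idx (fun i => n * N i)),
            ((n : ℝ) / supNorm σ) ^ α * |dpd n a N μ ν (tsh σ x) x'' - dpd n a N μ ν x x''| ≤
              C * Real.exp (-(δ / n * tdist (fun i => n * N i) x x'')) := by
  obtain ⟨δ, hδ, h⟩ := dpd_holder_unifAlpha d aminus aplus ha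
  refine ⟨δ, hδ, fun {α} hα0 hα1 => ?_⟩
  obtain ⟨C, hC, hCb⟩ := h hα0 hα1
  refine ⟨C * Real.exp δ, by positivity, fun n _ a ha1 ha2 N hN μ ν σ hσ0 hσn x x'' => ?_⟩
  refine (hCb n a ha1 ha2 N hN μ ν σ hσ0 hσn x x'').trans ?_
  rw [mul_assoc, ← Real.exp_add]
  apply mul_le_mul_of_nonneg_left _ hC
  apply Real.exp_le_exp.mpr
  have hn : (0 : ℝ) < n := by exact_mod_cast NeZero.pos n
  have ht := tdist_fine_le n hN x x''
  have hT := MultiPeriod.torusSupNorm_nonneg hN (coarse n (toZ x) - coarse n (toZ x''))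
  have htd := tdist_nonneg (fun i => n * N i) x x''
  have h1 : δ / n * tdist (fun i => n * N i) x x''
      ≤ δ * MultiPeriod.torusSupNorm N (coarse n (toZ x) - coarse n (toZ x'')) + δ := by
    rw [div_mul_eq_mul_div, div_le_iff₀ hn]
    have := mul_le_mul_of_nonneg_left ht hδ.le
    nlinarith
  linarith

/-! ### §5 The side condition «x, x′ : |x − x′| ≦ 1» in coordinates: the centred representative of `x′ − x` -/

/-- the centred representative `σ ∈ ℤ^{d+1}` of the class `x′ − x` on the torus `Π_i ℤ/P_i`: `σ_i ≡ x′_i − x_i (mod P_i)`,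
`|σ_i| = dist(x′_i − x_i, P_iℤ)`. [folklore] -/
def sigmaOf {P : Fin (d + 1) → ℕ} (x x' : Idx P) : Fin (d + 1) → ℤ :=
  MultiPeriod.translate P (toZ x' - toZ x) (MultiPeriod.centreVec P (toZ x' - toZ x))

/-- translating `x` by the representative of `x′ − x` gives `x′` — the dictionary behind the printed side condition
«for x, x′: |x − x′| ≦ 1» of (1.127): the cell's shift index `σ` ranges over all pairs `x, x′`.
[cite: Balaban1984PropagatorsI, (1.127) p.38 (side condition, dictionary)] -/
theorem tsh_sigmaOf {P : Fin (d + 1) → ℕ} (x x' : Idx P) : tsh (sigmaOf x x') x = x' := by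
  funext i
  apply Fin.ext
  show ((toZ x i + sigmaOf x x' i) % (P i : ℤ)).toNat = (x' i : ℕ)
  have h1 : toZ x i + sigmaOf x x' i
      = toZ x' i + (P i : ℤ) * MultiPeriod.centre (P i) ((toZ x' - toZ x) i) := by
    simp only [sigmaOf, MultiPeriod.translate_apply, MultiPeriod.centreVec, Pi.sub_apply]
    ring
  have h2 : toZ x' i % (P i : ℤ) = toZ x' i :=
    Int.emod_eq_of_lt (by simp only [B5QGGQ145Bounds.toZ]; positivity)
      (by simp only [B5QGGQ145Bounds.toZ]; exact_mod_cast (x' i).isLt)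
  rw [h1, Int.add_mul_emod_self_left, h2]
  simp only [B5QGGQ145Bounds.toZ, Int.toNat_natCast]

/-- translating by `0` does nothing. [folklore] -/
private theorem tsh_zero {P : Fin (d + 1) → ℕ} (x : Idx P) : tsh (0 : Fin (d + 1) → ℤ) x = x := by
  funext i
  apply Fin.ext
  show ((toZ x i + (0 : Fin (d + 1) → ℤ) i) % (P i : ℤ)).toNat = (x i : ℕ)
  have h2 : toZ x i % (P i : ℤ) = toZ x i :=
    Int.emod_eq_of_lt (by simp only [B5QGGQ145Bounds.toZ]; positivity)
      (by simp only [B5QGGQ145Bounds.toZ]; exact_mod_cast (x i).isLt)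
  rw [Pi.zero_apply, add_zero, h2]
  simp only [B5QGGQ145Bounds.toZ, Int.toNat_natCast]

/-- `|σ|_∞ = tdist(x, x′)`: the sup norm of the centred representative is the torus sup-distance in fine steps, i.e. the
cell's weight `(n/|σ|_∞)^α` IS the printed `1/|x − x′|^α` of (1.127) for the pair `x, x′ = x + σ`.
[cite: Balaban1984PropagatorsI, (1.127) p.38 (the weight `1/|x − x′|^α`, dictionary)] -/
theorem supNorm_sigmaOf {P : Fin (d + 1) → ℕ} (hP : ∀ i, 1 ≤ P i) (x x' : Idx P) :
    supNorm (sigmaOf x x') = tdist P x x' := by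
  rw [sigmaOf, MultiPeriod.supNorm_translate_centreVec hP, ← tdist_eq_torusSupNorm hP, tdist_symm hP]

/-- if the representative vanishes then `x = x′`. [folklore] -/
private theorem eq_of_sigmaOf_eq_zero {P : Fin (d + 1) → ℕ} {x x' : Idx P} (h : sigmaOf x x' = 0) : x = x' := by
  have := tsh_sigmaOf x x'
  rw [h, tsh_zero] at this
  exact this

/-- each coordinate of the representative is bounded by the torus distance: `|σ_i| ≤ tdist(x, x′)`. [folklore] -/
private theorem abs_sigmaOf_le {P : Fin (d + 1) → ℕ} (hP : ∀ i, 1 ≤ P i) (x x' : Idx P) (i : Fin (d + 1)) :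
    ((|sigmaOf x x' i| : ℤ) : ℝ) ≤ tdist P x x' := by
  rw [← supNorm_sigmaOf hP]
  exact abs_le_supNorm _ i

/-! ### §6 The concrete family and the inhabitation of `B5.Kernel126_127Printed` -/

/-- index of the concrete family: a scale `n = L^k ≥ 1` (so EVERY `k`), a constant `a ∈ [a₋, a₊]`, a period vector `N`
(`N_i ≥ 1`: every volume), and the two directions `μ, ν` of `(∂P∂^*)_{μν}`. [cite: Balaban1984PropagatorsI, (1.126)–(1.127) p.38
«independent of k», with (1.42) p.25 «a > 0 (we will put a = 1 finally)»] -/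
structure Index126 (d : ℕ) (aminus aplus : ℝ) where
  /-- fine points per unit block, `n = η⁻¹ = L^k` -/
  n : ℕ
  n_pos : 0 < n
  /-- the constant `a` of (1.42)–(1.45) -/
  a : ℝ
  ha1 : aminus ≤ a
  ha2 : a ≤ aplus
  /-- period vector of the unit torus `T₁^{(k)}` -/
  N : Fin (d + 1) → ℕ
  hN : ∀ i, 1 ≤ N i
  /-- the directions `μ, ν` -/
  μ : Fin (d + 1)
  ν : Fin (d + 1)

/-- **the concrete kernel data of (1.126)–(1.127)**: the fine torus `T_η = Π_j ℤ/(n N_j)`, the sup-distance `|x − x′|` in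
lattice units `η = 1/n` (`tdist/n`), and the `η`-weighted kernel `(∂P∂^*)_{μν}(x, x′) = dpd n a N μ ν x x′` of (1.120).
[cite: Balaban1984PropagatorsI, (1.120) p.37, (1.126)–(1.127) p.38] -/
def K126 {d : ℕ} (aminus aplus : ℝ) (i : Index126 d aminus aplus) : B5.KernelData where
  X := Idx (fun j => i.n * i.N j)
  dist := fun x x' => tdist (fun j => i.n * i.N j) x x' / i.n
  ker := fun x x' => @dpd d i.n ⟨i.n_pos.ne'⟩ i.a i.N i.μ i.ν x x'

/-- monotonicity of the exponential weight in the rate, for non-negative distances. [folklore] -/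
private theorem exp_rate_mono {δ δ' t : ℝ} (h : δ ≤ δ') (ht : 0 ≤ t) :
    Real.exp (-(δ' * t)) ≤ Real.exp (-(δ * t)) :=
  Real.exp_le_exp.mpr (by nlinarith)

/-- **ROW B5.Eq1.127 — `B5.Kernel126_127Printed` HOLDS FOR THE CONCRETE TORUS FAMILY.**  For `0 < a₋ ≤ a₊` there are ONE rate
`δ′₀ > 0`, one constant `C > 0` and a function `α ↦ C_α` such that for EVERY index `i = (n, a, N, μ, ν)` (every `k`, every
volume): (1.126) `|(∂P∂*)_{μν}(x,x′)| ≤ C e^{−δ′₀|x−x′|}` and (1.127) `|(∂P∂*)_{μν}(x,x″) − (∂P∂*)_{μν}(x′,x″)| ≤ C_α |x−x′|^α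
e^{−δ′₀|x−x″|}` for `|x − x′| ≤ 1`, `α < 1` — the abstract statement of `B5.lean` inhabited by name.
[cite: Balaban1984PropagatorsI, (1.126)–(1.127) p.38 with «The constant O(1) in (1.126) depends on d only, and in (1.127) it
depends on α also (O(1) → ∞ if α → 1)»; proof supplied by the audit (the printed route being Lemma 2.4 of [2], (1.45) and the
analyticity method)] -/
theorem kernel126_127Printed_torus (d : ℕ) (aminus aplus : ℝ) (ha : 0 < aminus) :
    B5.Kernel126_127Printed (K126 (d := d) aminus aplus) := by
  classical
  obtain ⟨δ₁, C₁, hδ₁, hC₁, h₁⟩ := dpd_decay_uniform_fine d aminus aplus ha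
  obtain ⟨δ₂, hδ₂, h₂⟩ := dpd_holder_unifAlpha_fine d aminus aplus ha
  -- the `α`-dependent constant: the `max α 0` bound serves every `α < 1`
  let Cα : ℝ → ℝ := fun α =>
    if h : max α 0 < 1 then Classical.choose (h₂ (le_max_right α 0) h) else 0
  refine ⟨min δ₁ δ₂, C₁ + 1, Cα, lt_min hδ₁ hδ₂, by linarith, fun i => ⟨?_, ?_⟩⟩
  · -- (1.126)
    intro x x'
    haveI : NeZero i.n := ⟨i.n_pos.ne'⟩
    have hn : (0 : ℝ) < i.n := by exact_mod_cast i.n_pos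
    have hb := h₁ i.n i.a i.ha1 i.ha2 i.N i.hN i.μ i.ν x x'
    have ht : 0 ≤ tdist (fun j => i.n * i.N j) x x' / i.n := div_nonneg (tdist_nonneg _ x x') hn.le
    show |dpd i.n i.a i.N i.μ i.ν x x'| ≤ (C₁ + 1) * Real.exp (-(min δ₁ δ₂ * (tdist (fun j => i.n * i.N j) x x' / i.n)))
    have e1 : δ₁ / i.n * tdist (fun j => i.n * i.N j) x x' = δ₁ * (tdist (fun j => i.n * i.N j) x x' / i.n) := by ring
    rw [e1] at hb
    refine hb.trans ?_
    exact mul_le_mul (by linarith) (exp_rate_mono (min_le_left _ _) ht) (Real.exp_pos _).le (by linarith)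
  · -- (1.127)
    intro α x x' x'' hα1 hdist
    haveI : NeZero i.n := ⟨i.n_pos.ne'⟩
    have hn : (0 : ℝ) < i.n := by exact_mod_cast i.n_pos
    have hnN : ∀ j, 1 ≤ i.n * i.N j := fun j => Nat.one_le_iff_ne_zero.mpr (Nat.mul_ne_zero (NeZero.ne i.n)
      (Nat.one_le_iff_ne_zero.mp (i.hN j)))
    -- the constant for this `α`
    have hβ0 : 0 ≤ max α 0 := le_max_right α 0
    have hβ1 : max α 0 < 1 := max_lt hα1 one_pos
    have hCα : Cα α = Classical.choose (h₂ hβ0 hβ1) := by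
      simp only [Cα, dif_pos hβ1]
    obtain ⟨hC, hCb⟩ := Classical.choose_spec (h₂ hβ0 hβ1)
    set C := Classical.choose (h₂ hβ0 hβ1) with hC_def
    rw [hCα]
    change |dpd i.n i.a i.N i.μ i.ν x x'' - dpd i.n i.a i.N i.μ i.ν x' x''| ≤
      C * (tdist (fun j => i.n * i.N j) x x' / i.n) ^ α *
        Real.exp (-(min δ₁ δ₂ * (tdist (fun j => i.n * i.N j) x x'' / i.n)))
    change tdist (fun j => i.n * i.N j) x x' / i.n ≤ 1 at hdist
    set D : ℝ := tdist (fun j => i.n * i.N j) x x' / i.n with hD_def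
    have hD0 : 0 ≤ D := div_nonneg (tdist_nonneg _ x x') hn.le
    have ht'' : 0 ≤ tdist (fun j => i.n * i.N j) x x'' / i.n := div_nonneg (tdist_nonneg _ x x'') hn.le
    by_cases hxx : x = x'
    · -- `x = x′`: the left side vanishes
      subst hxx
      rw [sub_self, abs_zero]
      exact mul_nonneg (mul_nonneg hC (Real.rpow_nonneg hD0 α)) (Real.exp_pos _).le
    · -- `x ≠ x′`: the centred representative `σ` of `x′ − x` is a legitimate shift
      set σ := sigmaOf x x' with hσ_def
      have hσ0 : σ ≠ 0 := fun h => hxx (eq_of_sigmaOf_eq_zero h)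
      have hsup : supNorm σ = tdist (fun j => i.n * i.N j) x x' := supNorm_sigmaOf hnN x x'
      have htd_le : tdist (fun j => i.n * i.N j) x x' ≤ i.n := by
        rwa [div_le_one hn] at hdist
      have hσn : ∀ j, |σ j| ≤ (i.n : ℤ) := by
        intro j
        have h := (abs_sigmaOf_le hnN x x' j).trans htd_le
        exact_mod_cast h
      have hb := hCb i.n i.a i.ha1 i.ha2 i.N i.hN i.μ i.ν σ hσ0 hσn x x''
      rw [tsh_sigmaOf] at hb
      -- `hb : (n/|σ|_∞)^β · |dpd x′ x″ − dpd x x″| ≤ C e^{−(δ₂/n) tdist(x,x″)}`, `β = max α 0`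
      have hs1 : 1 ≤ supNorm σ := one_le_supNorm hσ0
      have hspos : 0 < supNorm σ := by linarith
      have hDpos : 0 < D := by rw [hD_def, ← hsup]; positivity
      have hDeq : supNorm σ / i.n = D := by rw [hD_def, hsup]
      have hw : 0 < ((i.n : ℝ) / supNorm σ) ^ (max α 0) := Real.rpow_pos_of_pos (div_pos hn hspos) _
      -- isolate the difference
      have hb' : |dpd i.n i.a i.N i.μ i.ν x' x'' - dpd i.n i.a i.N i.μ i.ν x x''| ≤
          (((i.n : ℝ) / supNorm σ) ^ (max α 0))⁻¹ * (C * Real.exp (-(δ₂ / i.n * tdist (fun j => i.n * i.N j) x x''))) := by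
        rw [le_inv_mul_iff₀ hw]
        exact hb
      have hinv : (((i.n : ℝ) / supNorm σ) ^ (max α 0))⁻¹ = D ^ (max α 0) := by
        rw [← Real.inv_rpow (div_pos hn hspos).le, inv_div, hDeq]
      rw [hinv] at hb'
      -- `D^{max α 0} ≤ D^α` for `0 < D ≤ 1`
      have hpow : D ^ (max α 0) ≤ D ^ α := Real.rpow_le_rpow_of_exponent_ge hDpos hdist (le_max_left α 0)
      have e1 : δ₂ / i.n * tdist (fun j => i.n * i.N j) x x'' = δ₂ * (tdist (fun j => i.n * i.N j) x x'' / i.n) := by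
        ring
      rw [e1] at hb'
      have hexp := exp_rate_mono (min_le_right δ₁ δ₂) ht''
      rw [abs_sub_comm]
      calc |dpd i.n i.a i.N i.μ i.ν x' x'' - dpd i.n i.a i.N i.μ i.ν x x''|
          ≤ D ^ (max α 0) * (C * Real.exp (-(δ₂ * (tdist (fun j => i.n * i.N j) x x'' / i.n)))) := hb'
        _ ≤ D ^ α * (C * Real.exp (-(min δ₁ δ₂ * (tdist (fun j => i.n * i.N j) x x'' / i.n)))) := by
            apply mul_le_mul hpow (mul_le_mul_of_nonneg_left hexp hC) (by positivity) (Real.rpow_nonneg hD0 α)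
        _ = C * D ^ α * Real.exp (-(min δ₁ δ₂ * (tdist (fun j => i.n * i.N j) x x'' / i.n))) := by ring

/-- the same for the paper's eventual choice `a = 1` ((1.42) p.25 «we will put a = 1 finally»): the one-point range
`[1, 1]`. [cite: Balaban1984PropagatorsI, (1.126)–(1.127) p.38 with (1.42) p.25] -/
theorem kernel126_127Printed_torus_one (d : ℕ) : B5.Kernel126_127Printed (K126 (d := d) 1 1) :=
  kernel126_127Printed_torus d 1 1 one_pos

end

end Literature.MathematicalPhysics.QuantumFieldTheory.Balaban1983to89.B5Kernel126TorusInstance
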